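import Mathlib.RingTheory.Nullstellensatz
import Mathlib.RingTheory.Polynomial.UniqueFactorization
import Mathlib.Algebra.MvPolynomial.NoZeroDivisors
import Mathlib.Algebra.MvPolynomial.Nilpotent
import Mathlib.RingTheory.MvPolynomial.Homogeneous
import Mathlib.FieldTheory.IsAlgClosed.Basic
import HarnessLib

/-!
# Forms over an algebraically closed field whose zeros lie on finitely many hyperplanes are products of linear forms — proofs only

`Literature/NumberTheory/Transcendental/NesterenkoFormsOnHyperplanesK.lean`. The tree's
`NesterenkoFormsOnHyperplanes.lean` (toolkit of the proof of LNM 1752 Ch. 3 Prop. 4.13) proves, for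
COMPLEX polynomials `g ∈ ℂ[x₀, …, x_m]`, that a non-zero `g` vanishing on the hyperplanes `ℓ_β̄ = 0`
(`β̄ ∈ W`) and whose zeros all lie on them is `c · ∏_{i < deg g} ℓ_{β̄ᵢ}` with `β̄ᵢ ∈ W`. Its proof is
purely algebraic (Nullstellensatz and unique factorisation), and the estimates of LNM 1752 Ch. 3
Prop. 4.11 2)–3) ([Nes10, Prop. 1.4]) need the same splitting of the specialised associated form
over OTHER algebraically closed fields of characteristic `0` — the algebraic closure of `ℚ(u′)`
(generic linear section) and `ℂ_p` / `ℚ̄_p` (Gauss norms at the finite places). This file therefore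
re-proves the toolkit verbatim over an arbitrary algebraically closed field `K`
(`ℓ_β̄ = ∑ⱼ βⱼ xⱼ`, `β̄ ∈ K^{m+1} ∖ 0`):

* `linK_dvd_of_forall_eval` — `g` vanishes on `ℓ_β̄ = 0` ⇒ `ℓ_β̄ ∣ g`;
* `card_le_totalDegree_of_linK_dvd` — pairwise non-proportional `β̄` with `ℓ_β̄ ∣ g ≠ 0` are at
  most `deg g`;
* `exists_eq_C_mul_prod_linK` — the factorisation `g = c ∏_{i < deg g} ℓ_{β̄ᵢ}`, `c ≠ 0`, `β̄ᵢ ∈ W`.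

## References

* [NesterenkoPhilippon2001] Yu. V. Nesterenko, P. Philippon (eds.), *Introduction to Algebraic
  Independence Theory*, LNM 1752, Springer 2001, Ch. 3 §4 (pp. 38–41), Prop. 4.11, Prop. 4.13.
* [Nes10] Yu. V. Nesterenko, Proc. Steklov Inst. Math. 218 (1997) 294–331, Prop. 1.4.
-/

noncomputable section

open MvPolynomial

namespace Literature.NumberTheory.Transcendental

namespace Nesterenko

variable {K : Type*} [Field K] {m : ℕ}

/-! ### The linear forms `ℓ_β̄ = ∑ⱼ βⱼ xⱼ` -/

/-- `ℓ_β̄(u) = ∑ⱼ βⱼ uⱼ`. [folklore] -/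
theorem eval_linK (β u : Fin (m + 1) → K) :
    eval u ((∑ j, C (β j) * X j) : MvPolynomial (Fin (m + 1)) K) = ∑ j, β j * u j := by
  simp [map_sum, eval_C, eval_X]

/-- The coefficient of `xⱼ` in `ℓ_β̄` is `βⱼ`. [folklore] -/
theorem coeff_single_linK (β : Fin (m + 1) → K) (j : Fin (m + 1)) :
    coeff (Finsupp.single j 1) ((∑ j, C (β j) * X j) : MvPolynomial (Fin (m + 1)) K) = β j := by
  classical
  rw [coeff_sum]
  simp only [coeff_C_mul, coeff_X, Finsupp.single_left_inj one_ne_zero, mul_ite, mul_one,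
    mul_zero]
  rw [Finset.sum_ite_eq']
  simp

/-- `ℓ_β̄ ≠ 0` for `β̄ ≠ 0`. [folklore] -/
theorem linK_ne_zero {β : Fin (m + 1) → K} (hβ : β ≠ 0) :
    ((∑ j, C (β j) * X j) : MvPolynomial (Fin (m + 1)) K) ≠ 0 := by
  obtain ⟨j, hj⟩ := Function.ne_iff.mp hβ
  intro h
  apply hj
  rw [← coeff_single_linK β j, h, coeff_zero]
  rfl

/-- `ℓ_β̄` is a form of degree `1`. [folklore] -/
theorem isHomogeneous_linK (β : Fin (m + 1) → K) :
    ((∑ j, C (β j) * X j) : MvPolynomial (Fin (m + 1)) K).IsHomogeneous 1 :=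
  IsHomogeneous.sum _ _ _ fun j _ => (isHomogeneous_X _ j).C_mul _

/-- `deg ℓ_β̄ = 1` for `β̄ ≠ 0`. [folklore] -/
theorem totalDegree_linK {β : Fin (m + 1) → K} (hβ : β ≠ 0) :
    ((∑ j, C (β j) * X j) : MvPolynomial (Fin (m + 1)) K).totalDegree = 1 :=
  (isHomogeneous_linK β).totalDegree (linK_ne_zero hβ)

/-- `ℓ_{c β̄} = c ℓ_β̄`. [folklore] -/
theorem linK_smul (c : K) (β : Fin (m + 1) → K) :
    ((∑ j, C ((c • β) j) * X j) : MvPolynomial (Fin (m + 1)) K) = C c * (∑ j, C (β j) * X j) := by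
  rw [Finset.mul_sum]
  refine Finset.sum_congr rfl fun j _ => ?_
  rw [Pi.smul_apply, smul_eq_mul, map_mul, mul_assoc]

/-- A polynomial of total degree `0` that is non-zero is a unit (over a field). [folklore] -/
theorem isUnit_of_totalDegree_eq_zero_K {a : MvPolynomial (Fin (m + 1)) K} (ha : a ≠ 0)
    (hdeg : a.totalDegree = 0) : IsUnit a := by
  rw [totalDegree_eq_zero_iff_eq_C] at hdeg
  have hc : a.coeff 0 ≠ 0 := by
    intro h
    apply ha
    rw [hdeg, h, C_0]
  rw [hdeg]
  exact (IsUnit.mk0 _ hc).map C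

/-- `ℓ_β̄` is irreducible for `β̄ ≠ 0` (degrees add over a domain). [folklore] -/
theorem irreducible_linK {β : Fin (m + 1) → K} (hβ : β ≠ 0) :
    Irreducible ((∑ j, C (β j) * X j) : MvPolynomial (Fin (m + 1)) K) := by
  have hdeg := totalDegree_linK hβ
  refine ⟨fun hu => ?_, fun a b hab => ?_⟩
  · have := (isUnit_iff_totalDegree_of_isReduced.mp hu).2
    omega
  · have ha : a ≠ 0 := by rintro rfl; exact linK_ne_zero hβ (by rw [hab, zero_mul])
    have hb : b ≠ 0 := by rintro rfl; exact linK_ne_zero hβ (by rw [hab, mul_zero])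
    have hsum := totalDegree_mul_of_isDomain ha hb
    rw [← hab, hdeg] at hsum
    rcases Nat.eq_zero_or_pos a.totalDegree with h0 | h0
    · exact Or.inl (isUnit_of_totalDegree_eq_zero_K ha h0)
    · exact Or.inr (isUnit_of_totalDegree_eq_zero_K hb (by omega))

/-- `ℓ_β̄` is prime for `β̄ ≠ 0`. [folklore] -/
theorem prime_linK {β : Fin (m + 1) → K} (hβ : β ≠ 0) :
    Prime ((∑ j, C (β j) * X j) : MvPolynomial (Fin (m + 1)) K) :=
  UniqueFactorizationMonoid.irreducible_iff_prime.mp (irreducible_linK hβ)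

/-- **A polynomial vanishing on the hyperplane `ℓ_β̄ = 0` is divisible by `ℓ_β̄`** (Nullstellensatz
for the prime `ℓ_β̄`). [folklore] -/
theorem linK_dvd_of_forall_eval [IsAlgClosed K] {β : Fin (m + 1) → K} (hβ : β ≠ 0)
    {g : MvPolynomial (Fin (m + 1)) K} (h : ∀ u : Fin (m + 1) → K, ∑ j, β j * u j = 0 → eval u g = 0) :
    ((∑ j, C (β j) * X j) : MvPolynomial (Fin (m + 1)) K) ∣ g := by
  have hmem : g ∈ vanishingIdeal K
      (zeroLocus K (Ideal.span {((∑ j, C (β j) * X j) : MvPolynomial (Fin (m + 1)) K)})) := by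
    rw [mem_vanishingIdeal_iff]
    intro u hu
    rw [zeroLocus_span] at hu
    have h1 : eval u ((∑ j, C (β j) * X j) : MvPolynomial (Fin (m + 1)) K) = 0 := hu _ (Set.mem_singleton _)
    rw [eval_linK] at h1
    exact h u h1
  rwa [vanishingIdeal_zeroLocus_eq_radical,
    ((Ideal.span_singleton_prime (linK_ne_zero hβ)).mpr (prime_linK hβ)).radical,
    Ideal.mem_span_singleton] at hmem

/-- If `ℓ_ā ∣ ℓ_β̄` (`ā, β̄ ≠ 0`) then `β̄` is a multiple of `ā`. [folklore] -/
theorem eq_smul_of_linK_dvd_linK {a β : Fin (m + 1) → K} (ha : a ≠ 0) (hβ : β ≠ 0)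
    (h : ((∑ j, C (a j) * X j) : MvPolynomial (Fin (m + 1)) K) ∣ (∑ j, C (β j) * X j)) : ∃ c : K, β = c • a := by
  obtain ⟨w, hw⟩ := h
  have hw0 : w ≠ 0 := by rintro rfl; exact linK_ne_zero hβ (by rw [hw, mul_zero])
  have hdeg : w.totalDegree = 0 := by
    have h1 := totalDegree_mul_of_isDomain (linK_ne_zero ha) hw0
    rw [← hw, totalDegree_linK ha, totalDegree_linK hβ] at h1
    omega
  rw [totalDegree_eq_zero_iff_eq_C] at hdeg
  obtain ⟨c, hc⟩ : ∃ c : K, w = C c := ⟨_, hdeg⟩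
  rw [hc] at hw
  refine ⟨c, funext fun j => ?_⟩
  have e : ((∑ j, C (β j) * X j) : MvPolynomial (Fin (m + 1)) K) = (∑ j, C ((c • a) j) * X j) := by
    rw [linK_smul, hw, mul_comm]
  have := congrArg (coeff (Finsupp.single j 1)) e
  rwa [coeff_single_linK, coeff_single_linK] at this

/-! ### Finitely many directions -/

/-- The product of the `ℓ_β̄` over pairwise non-proportional `β̄`'s all dividing `g` divides `g`.
[folklore] -/
theorem prod_linK_dvd {g : MvPolynomial (Fin (m + 1)) K} (s : Finset (Fin (m + 1) → K))
    (hs0 : ∀ β ∈ s, β ≠ 0)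
    (hsep : ∀ β ∈ s, ∀ β' ∈ s, β ≠ β' → ∀ c : K, β' ≠ c • β)
    (hdvd : ∀ β ∈ s, ((∑ j, C (β j) * X j) : MvPolynomial (Fin (m + 1)) K) ∣ g) :
    (∏ β ∈ s, (∑ j, C (β j) * X j) : MvPolynomial (Fin (m + 1)) K) ∣ g := by
  classical
  induction s using Finset.induction_on with
  | empty => simp
  | insert a s ha ih =>
    have hs0' : ∀ β ∈ s, β ≠ 0 := fun β hβ => hs0 β (Finset.mem_insert_of_mem hβ)
    have hsep' : ∀ β ∈ s, ∀ β' ∈ s, β ≠ β' → ∀ c : K, β' ≠ c • β :=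
      fun β hβ β' hβ' => hsep β (Finset.mem_insert_of_mem hβ) β' (Finset.mem_insert_of_mem hβ')
    obtain ⟨h, hh⟩ := ih hs0' hsep' fun β hβ => hdvd β (Finset.mem_insert_of_mem hβ)
    have ha0 : a ≠ 0 := hs0 a (Finset.mem_insert_self a s)
    have hpa := prime_linK ha0
    have hadvd : ((∑ j, C (a j) * X j) : MvPolynomial (Fin (m + 1)) K) ∣ (∏ β ∈ s, (∑ j, C (β j) * X j)) * h := by
      rw [← hh]; exact hdvd a (Finset.mem_insert_self a s)
    rcases hpa.dvd_or_dvd hadvd with h1 | h1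
    · -- `ℓ_a` divides some `ℓ_β`, `β ∈ s`: then `β` is a multiple of `a`, excluded
      exfalso
      obtain ⟨β, hβ, hβdvd⟩ := (hpa.dvd_finsetProd_iff _).mp h1
      obtain ⟨c, hc⟩ := eq_smul_of_linK_dvd_linK ha0 (hs0' β hβ) hβdvd
      have hne : a ≠ β := fun h' => ha (h' ▸ hβ)
      exact hsep a (Finset.mem_insert_self a s) β (Finset.mem_insert_of_mem hβ) hne c hc
    · obtain ⟨h', hh'⟩ := h1
      refine ⟨h', ?_⟩
      rw [Finset.prod_insert ha, hh, hh']
      ring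

/-- `deg ∏_{β̄ ∈ s} ℓ_β̄ = #s` for non-zero `β̄`'s. [folklore] -/
theorem totalDegree_prod_linK (s : Finset (Fin (m + 1) → K)) (hs0 : ∀ β ∈ s, β ≠ 0) :
    (∏ β ∈ s, (∑ j, C (β j) * X j) : MvPolynomial (Fin (m + 1)) K).totalDegree = s.card ∧
      (∏ β ∈ s, (∑ j, C (β j) * X j) : MvPolynomial (Fin (m + 1)) K) ≠ 0 := by
  classical
  induction s using Finset.induction_on with
  | empty => simp
  | insert a s ha ih =>
    obtain ⟨hdeg, hne⟩ := ih fun β hβ => hs0 β (Finset.mem_insert_of_mem hβ)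
    have ha0 : a ≠ 0 := hs0 a (Finset.mem_insert_self a s)
    rw [Finset.prod_insert ha, Finset.card_insert_of_notMem ha]
    refine ⟨?_, mul_ne_zero (linK_ne_zero ha0) hne⟩
    rw [totalDegree_mul_of_isDomain (linK_ne_zero ha0) hne, totalDegree_linK ha0, hdeg]
    omega

/-- **Pairwise non-proportional `β̄`'s with `ℓ_β̄ ∣ g ≠ 0` are at most `deg g` in number.**
[folklore] -/
theorem card_le_totalDegree_of_linK_dvd {g : MvPolynomial (Fin (m + 1)) K} (hg : g ≠ 0)
    (s : Finset (Fin (m + 1) → K)) (hs0 : ∀ β ∈ s, β ≠ 0)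
    (hsep : ∀ β ∈ s, ∀ β' ∈ s, β ≠ β' → ∀ c : K, β' ≠ c • β)
    (hdvd : ∀ β ∈ s, ((∑ j, C (β j) * X j) : MvPolynomial (Fin (m + 1)) K) ∣ g) : s.card ≤ g.totalDegree := by
  rw [← (totalDegree_prod_linK s hs0).1]
  exact totalDegree_le_of_dvd_of_isDomain (prod_linK_dvd s hs0 hsep hdvd) hg

/-- A maximal pairwise non-proportional finite subset of a set `W` of non-zero vectors, when the
sizes of such subsets are bounded: every vector of `W` is proportional to one of its elements.
[folklore] -/
theorem exists_maximal_nonproportional_K {W : Set (Fin (m + 1) → K)} (hW0 : ∀ β ∈ W, β ≠ 0)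
    {N : ℕ} (hbound : ∀ s : Finset (Fin (m + 1) → K), ↑s ⊆ W →
      (∀ β ∈ s, ∀ β' ∈ s, β ≠ β' → ∀ c : K, β' ≠ c • β) → s.card ≤ N) :
    ∃ s : Finset (Fin (m + 1) → K), ↑s ⊆ W ∧
      (∀ β ∈ s, ∀ β' ∈ s, β ≠ β' → ∀ c : K, β' ≠ c • β) ∧
      ∀ β ∈ W, ∃ β₀ ∈ s, ∃ c : K, β = c • β₀ := by
  classical
  set S : Set ℕ := {k | ∃ s : Finset (Fin (m + 1) → K), ↑s ⊆ W ∧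
    (∀ β ∈ s, ∀ β' ∈ s, β ≠ β' → ∀ c : K, β' ≠ c • β) ∧ s.card = k} with hS
  have hne : S.Nonempty := ⟨0, ∅, by simp, by simp, rfl⟩
  have hbdd : BddAbove S := ⟨N, fun k ⟨s, hsW, hsep, hk⟩ => hk ▸ hbound s hsW hsep⟩
  obtain ⟨s, hsW, hsep, hcard⟩ := Nat.sSup_mem hne hbdd
  refine ⟨s, hsW, hsep, fun β hβ => ?_⟩
  by_contra hcon
  push Not at hcon
  have hβs : β ∉ s := fun h => hcon β h 1 (by rw [one_smul])
  have hβ0 : β ≠ 0 := hW0 β hβ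
  -- `insert β s` is again admissible, of larger size
  have hins : (insert β s).card ∈ S := by
    refine ⟨insert β s, ?_, ?_, rfl⟩
    · rw [Finset.coe_insert]
      exact Set.insert_subset hβ hsW
    · intro b hb b' hb' hbb' c
      rw [Finset.mem_insert] at hb hb'
      rcases hb with rfl | hb <;> rcases hb' with rfl | hb'
      · exact absurd rfl hbb'
      · -- `b' ∈ s`, `b = β`: if `b' = c • β` then `β = c⁻¹ • b'`
        intro h
        have hc : c ≠ 0 := by
          rintro rfl
          exact hW0 b' (hsW hb') (by rw [h, zero_smul])
        exact hcon b' hb' c⁻¹ (by rw [h, smul_smul, inv_mul_cancel₀ hc, one_smul])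
      · exact hcon b hb c
      · exact hsep b hb b' hb' hbb' c
  have hle := le_csSup hbdd hins
  rw [Finset.card_insert_of_notMem hβs, hcard] at hle
  omega

/-! ### The factorisation -/

/-- Factorisation, finite version: if every zero of `g ≠ 0` lies on some hyperplane `ℓ_β̄ = 0` with
`β̄` in the finite set `W₀` of non-zero vectors, then `g = c ∏_{i < deg g} ℓ_{β̄ᵢ}`, `c ≠ 0`,
`β̄ᵢ ∈ W₀`. [folklore] -/
theorem exists_eq_C_mul_prod_linK_of_finset [IsAlgClosed K] (W₀ : Finset (Fin (m + 1) → K))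
    (hW0 : ∀ β ∈ W₀, β ≠ 0) :
    ∀ (N : ℕ) (g : MvPolynomial (Fin (m + 1)) K), g ≠ 0 → g.totalDegree = N →
      (∀ u : Fin (m + 1) → K, eval u g = 0 → ∃ β ∈ W₀, ∑ j, β j * u j = 0) →
      ∃ c : K, c ≠ 0 ∧ ∃ β : Fin N → (Fin (m + 1) → K), (∀ i, β i ∈ W₀) ∧
        g = C c * ∏ i, (∑ j, C (β i j) * X j) := by
  classical
  intro N
  induction N with
  | zero =>
    intro g hg hdeg _
    rw [totalDegree_eq_zero_iff_eq_C] at hdeg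
    refine ⟨g.coeff 0, fun h => hg (by rw [hdeg, h, C_0]), fun i => i.elim0, fun i => i.elim0, ?_⟩
    simp [← hdeg]
  | succ N ih =>
    intro g hg hdeg hZ
    -- an irreducible factor `q` of `g`
    have hnu : ¬ IsUnit g := fun hu => by
      have := (isUnit_iff_totalDegree_of_isReduced.mp hu).2
      omega
    obtain ⟨q, hq, hqg⟩ := WfDvdMonoid.exists_irreducible_factor hnu hg
    have hqprime : Prime q := UniqueFactorizationMonoid.irreducible_iff_prime.mp hq
    have hq0 : q ≠ 0 := hq.ne_zero
    -- `q` divides `P = ∏_{W₀} ℓ_β̄`, whose zero set contains that of `q`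
    set P : MvPolynomial (Fin (m + 1)) K := ∏ β ∈ W₀, (∑ j, C (β j) * X j) with hP
    have hPmem : P ∈ vanishingIdeal K (zeroLocus K (Ideal.span {q})) := by
      rw [mem_vanishingIdeal_iff]
      intro u hu
      rw [zeroLocus_span] at hu
      have hqu : eval u q = 0 := hu q (Set.mem_singleton q)
      have hgu : eval u g = 0 := by
        obtain ⟨t, ht⟩ := hqg
        rw [ht, map_mul, hqu, zero_mul]
      obtain ⟨β, hβ, hβu⟩ := hZ u hgu
      show eval u P = 0
      rw [hP, map_prod]
      exact Finset.prod_eq_zero hβ (by rw [eval_linK, hβu])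
    rw [vanishingIdeal_zeroLocus_eq_radical, ((Ideal.span_singleton_prime hq0).mpr hqprime).radical,
      Ideal.mem_span_singleton, hP] at hPmem
    obtain ⟨β, hβW, hqβ⟩ := (hqprime.dvd_finsetProd_iff _).mp hPmem
    have hβ0 : β ≠ 0 := hW0 β hβW
    -- hence `q ~ ℓ_β` and `ℓ_β ∣ g`
    have hβg : ((∑ j, C (β j) * X j) : MvPolynomial (Fin (m + 1)) K) ∣ g := by
      obtain ⟨w, hw⟩ := hqβ
      rcases (irreducible_linK hβ0).isUnit_or_isUnit hw with hu | hu
      · exact absurd hu hq.not_isUnit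
      · obtain ⟨w', hw'⟩ := hu.exists_right_inv
        have : q = (∑ j, C (β j) * X j) * w' := by rw [hw, mul_assoc, hw', mul_one]
        exact Dvd.dvd.trans ⟨w', this⟩ hqg
    obtain ⟨g', hg'⟩ := hβg
    have hg'0 : g' ≠ 0 := by rintro rfl; exact hg (by rw [hg', mul_zero])
    have hdeg' : g'.totalDegree = N := by
      have h1 := totalDegree_mul_of_isDomain (linK_ne_zero hβ0) hg'0
      rw [← hg', hdeg, totalDegree_linK hβ0] at h1
      omega
    have hZ' : ∀ u : Fin (m + 1) → K, eval u g' = 0 → ∃ β ∈ W₀, ∑ j, β j * u j = 0 :=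
      fun u hu => hZ u (by rw [hg', map_mul, hu, mul_zero])
    obtain ⟨c, hc, β', hβ'W, hg'eq⟩ := ih g' hg'0 hdeg' hZ'
    refine ⟨c, hc, Fin.cons β β', fun i => Fin.cases hβW (fun i => hβ'W i) i, ?_⟩
    rw [Fin.prod_univ_succ, Fin.cons_zero]
    simp only [Fin.cons_succ]
    rw [hg', hg'eq]
    ring

/-- **Factorisation of a form whose zeros lie on hyperplanes.** Let `g ∈ K[x₀, …, x_m]` (`K` algebraically closed), `g ≠ 0`,
and let `W` be a set of non-zero vectors such that `g` vanishes on every hyperplane `ℓ_β̄ = 0`,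
`β̄ ∈ W`, and every zero of `g` lies on one of them. Then `g = c ∏_{i < deg g} ℓ_{β̄ᵢ}` with
`c ≠ 0` and `β̄ᵢ ∈ W`. [folklore] -/
theorem exists_eq_C_mul_prod_linK [IsAlgClosed K] {g : MvPolynomial (Fin (m + 1)) K} (hg : g ≠ 0)
    {W : Set (Fin (m + 1) → K)} (hW0 : ∀ β ∈ W, β ≠ 0)
    (hW : ∀ β ∈ W, ∀ u : Fin (m + 1) → K, ∑ j, β j * u j = 0 → eval u g = 0)
    (hZ : ∀ u : Fin (m + 1) → K, eval u g = 0 → ∃ β ∈ W, ∑ j, β j * u j = 0) :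
    ∃ c : K, c ≠ 0 ∧ ∃ β : Fin g.totalDegree → (Fin (m + 1) → K), (∀ i, β i ∈ W) ∧
      g = C c * ∏ i, (∑ j, C (β i j) * X j) := by
  classical
  have hdvd : ∀ β ∈ W, ((∑ j, C (β j) * X j) : MvPolynomial (Fin (m + 1)) K) ∣ g :=
    fun β hβ => linK_dvd_of_forall_eval (hW0 β hβ) (hW β hβ)
  obtain ⟨s, hsW, -, hmax⟩ := exists_maximal_nonproportional_K hW0 (N := g.totalDegree)
    fun s hsW hsep => card_le_totalDegree_of_linK_dvd hg s (fun β hβ => hW0 β (hsW hβ)) hsep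
      fun β hβ => hdvd β (hsW hβ)
  have hZ' : ∀ u : Fin (m + 1) → K, eval u g = 0 → ∃ β ∈ s, ∑ j, β j * u j = 0 := by
    intro u hu
    obtain ⟨β, hβW, hβu⟩ := hZ u hu
    obtain ⟨β₀, hβ₀, c, rfl⟩ := hmax β hβW
    have hc : c ≠ 0 := by
      rintro rfl
      exact hW0 _ hβW (zero_smul _ _)
    refine ⟨β₀, hβ₀, ?_⟩
    have e : ∑ j, (c • β₀) j * u j = c * ∑ j, β₀ j * u j := by
      rw [Finset.mul_sum]
      exact Finset.sum_congr rfl fun j _ => by rw [Pi.smul_apply, smul_eq_mul, mul_assoc]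
    rw [e] at hβu
    exact (mul_eq_zero.mp hβu).resolve_left hc
  obtain ⟨c, hc, β, hβs, hgeq⟩ := exists_eq_C_mul_prod_linK_of_finset s
    (fun β hβ => hW0 β (hsW hβ)) g.totalDegree g hg rfl hZ'
  exact ⟨c, hc, β, fun i => hsW (hβs i), hgeq⟩

end Nesterenko

end Literature.NumberTheory.Transcendental

end
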